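import Mathlib
import Literature.Analysis.FluidPDE.VectorCalculus
import Literature.Analysis.FluidPDE.LeiZhang2011Proofs
import Summits.NavierStokesRegularity.NavierStokesRegularity.Theorems.FilamentSkeletonRssClause13RAdjointPuncturedApriori
import Summits.NavierStokesRegularity.NavierStokesRegularity.Theorems.FilamentSkeletonRssClause13RAdjointWaistSourced
import Summits.NavierStokesRegularity.NavierStokesRegularity.Theorems.FilamentSkeletonRssClause13RAdjointWaistSourcedLeft

/-!
# Clause 13-R, STUB R at MODEL level: the edge-sourced density is bounded IN SUP NORM by its atoms, with an explicit constant
# (quantitative companion of census item (R-c′-E); crux `Clause13RNearStraightL`, stmt-NavierStokesRegularity-23612; line `rate_bordered_split`,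
# STUB R `stub_rateRow13RFlat`)

Route `FilamentSkeletonRss`, Variant A1R.  For the MODEL adjoint equation sourced by the edge kernels of two atoms `e₊` (at `b`), `e₋` (at `a`),
  `cst • (m σ • (φ σ × d) − ∫_{τ∈S} k(τ−σ) • (φ τ × d) dτ) + ½ φ σ + α e × φ σ + w′ σ φ σ + w σ φ′ σ = cst • (k(σ−b) • (e₊ × d) + k(σ−a) • (e₋ × d))`,
the tree has: existence of a continuous bounded punctured density (`…Clause13RAdjointModelExistence`, p837535 — by the Fredholm alternative, hence WITHOUT a
constant), uniqueness (p832285) and the `L²` bound `∫_S ‖φ‖² ≤ ε⁻²(b − a)(|cst|K‖d‖(‖e₊‖ + ‖e₋‖))²` (`…PuncturedApriori.edge_density_l2_le_atoms`, p832351).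
THIS FILE turns the `L²` bound into an explicit SUP bound — the quantity that enters a pairing-floor estimate for the edge measure against the rate column
(census item (R-S1)):
* `sq_setIntegral_le_mul_setIntegral_sq` — `(∫_S u)² ≤ (b − a) ∫_S u²` (variance is nonnegative; no Hölder machinery);
* `norm_nonlocal_le_of_sq` — `‖∫_S k(τ−σ) • (φ τ × d) dτ‖ ≤ K‖d‖ ∫_S ‖φ‖`;
* `local_of_full` — the full equation read as the LOCAL sourced equation with source `edge kernels + cst • (nonlocal term)`;
* `edge_density_sup_le_atoms` — **`‖φ(σ)‖ ≤ A (1 + |cst| K ‖d‖ (b − a)/ε)/κ₁` on the whole ball, `A = |cst| K ‖d‖ (‖e₊‖ + ‖e₋‖)`**, for every continuous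
  bounded punctured solution, when the slip opens at least linearly on both sides (`κ₁|s − c| ≤ |w(s)|` on `S`): the sourced waist law
  `…WaistSourced.norm_le_of_waistRegular_right` / `…WaistSourcedLeft.wnorm_le_of_waistRegular_left` with the source bound fed by the `L²` estimate.
Planner-facing: with the atoms normalised (`‖e₊‖ + ‖e₋‖ = 1`) the density part of the pairing `⟪μ, R⟫ = ⟪e₊, R(b)⟫ + ⟪e₋, R(a)⟫ + ∫_S ⟪φ, R⟫` is at most
`A(1 + |cst|K‖d‖(b − a)/ε)/κ₁ · ∫_S ‖R‖` — an explicit, checkable floor criterion at model level (the Γ-bookkeeping of `b − a ≍ 2R_b√(Γ log Γ)`, `K`, `cst` is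
the kit item (R-S1)).  [folklore]
Hand `leafhand-ns-filamentskeletonrs-25-g0` (LAND-ONLY); `--supports stmt-NavierStokesRegularity-23612` helper, def-free.  HONEST FRAMING: estimates for the MODEL
adjoint equation attached to a HYPOTHETICAL filament skeleton on the NEGATIVE side of a MODEL blow-up route; STUB R is NOT proved here and nothing in this file
bears on Navier–Stokes regularity or blow-up.
-/

noncomputable section

open MeasureTheory Filter Topology Set intervalIntegral
open scoped RealInnerProductSpace InnerProductSpace
open Literature.Analysis.FluidPDE
open Summit.NavierStokesRegularity.NavierStokesRegularity.Theorems.Clause13RAdjointPuncturedApriori (edge_density_l2_le_atoms)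
open Summit.NavierStokesRegularity.NavierStokesRegularity.Theorems.Clause13RAdjointWaistSourced
  (norm_le_of_waistRegular_right waistRegular_of_bounded_right)
open Summit.NavierStokesRegularity.NavierStokesRegularity.Theorems.Clause13RAdjointWaistSourcedLeft (wnorm_le_of_waistRegular_left)

namespace Summit.NavierStokesRegularity.NavierStokesRegularity.Theorems.Clause13REdgeDensityBounds
set_option linter.dupNamespace false

/-! ## §1 An elementary Cauchy–Schwarz on the ball -/

/-- `(∫_{[a,b]} u)² ≤ (b − a) ∫_{[a,b]} u²` for `u` with `u, u²` integrable on `[a, b]` (`a < b`): the variance of `u` is nonnegative. [folklore] -/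
theorem sq_setIntegral_le_mul_setIntegral_sq {a b : ℝ} (hab : a < b) {u : ℝ → ℝ} (hu : IntegrableOn u (Icc a b))
    (hu2 : IntegrableOn (fun x => u x ^ 2) (Icc a b)) :
    (∫ x in Icc a b, u x) ^ 2 ≤ (b - a) * ∫ x in Icc a b, u x ^ 2 := by
  set L : ℝ := b - a with hL
  have hL0 : 0 < L := by rw [hL]; linarith
  set I : ℝ := ∫ x in Icc a b, u x with hI
  set J : ℝ := ∫ x in Icc a b, u x ^ 2 with hJ
  have hvol : volume.real (Icc a b) = L := by rw [Real.volume_real_Icc_of_le hab.le]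
  haveI : IsFiniteMeasure (volume.restrict (Icc a b)) := by
    refine ⟨?_⟩; rw [Measure.restrict_apply_univ]; exact measure_Icc_lt_top
  have hc : IntegrableOn (fun _ => (I / L) ^ 2) (Icc a b) := integrableOn_const (hs := by exact measure_Icc_lt_top.ne)
  have hmu : IntegrableOn (fun x => 2 * (I / L) * u x) (Icc a b) := hu.const_mul _
  have hexp : ∫ x in Icc a b, (u x - I / L) ^ 2 = J - 2 * (I / L) * I + (I / L) ^ 2 * L := by
    have h1 : ∀ x, (u x - I / L) ^ 2 = (u x ^ 2 - 2 * (I / L) * u x) + (I / L) ^ 2 := fun x => by ring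
    simp_rw [h1]
    have e1 : ∫ x in Icc a b, ((u x ^ 2 - 2 * (I / L) * u x) + (I / L) ^ 2)
        = (∫ x in Icc a b, (u x ^ 2 - 2 * (I / L) * u x)) + ∫ x in Icc a b, (I / L) ^ 2 := integral_add (hu2.sub hmu) hc
    have e2 : ∫ x in Icc a b, (u x ^ 2 - 2 * (I / L) * u x) = (∫ x in Icc a b, u x ^ 2) - ∫ x in Icc a b, 2 * (I / L) * u x :=
      integral_sub hu2 hmu
    have e3 : ∫ x in Icc a b, 2 * (I / L) * u x = 2 * (I / L) * ∫ x in Icc a b, u x := MeasureTheory.integral_const_mul _ _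
    have e4 : ∫ x in Icc a b, (I / L) ^ 2 = (volume.real (Icc a b)) • (I / L) ^ 2 := setIntegral_const _
    rw [e1, e2, e3, e4, hvol, smul_eq_mul]
    ring
  have hnn : 0 ≤ ∫ x in Icc a b, (u x - I / L) ^ 2 := integral_nonneg fun x => sq_nonneg _
  rw [hexp] at hnn
  have hkey : J - 2 * (I / L) * I + (I / L) ^ 2 * L = J - I ^ 2 / L := by field_simp; ring
  rw [hkey] at hnn
  have h2 : I ^ 2 / L ≤ J := by linarith
  rwa [div_le_iff₀ hL0, mul_comm] at h2

/-! ## §2 Sup bound of the nonlocal term by the `L¹` size of the density -/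

/-- **Sup bound of the nonlocal term**: `‖∫_{[a,b]} k(τ−σ) • (φ τ × d) dτ‖ ≤ K‖d‖ ∫_{[a,b]} ‖φ‖` when `|k(τ − σ)| ≤ K` on the ball and `φ` is
continuous on the ball. [folklore] -/
theorem norm_nonlocal_le_of_sq {a b K σ : ℝ} {k : ℝ → ℝ} {φ : ℝ → EuclideanSpace ℝ (Fin 3)} (d : EuclideanSpace ℝ (Fin 3))
    (hK : ∀ τ ∈ Icc a b, |k (τ - σ)| ≤ K) (hK0 : 0 ≤ K) (hφc : ContinuousOn φ (Icc a b)) :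
    ‖∫ τ in Icc a b, k (τ - σ) • cross (φ τ) d‖ ≤ K * ‖d‖ * ∫ τ in Icc a b, ‖φ τ‖ := by
  have hint : IntegrableOn (fun τ => ‖φ τ‖) (Icc a b) := hφc.norm.integrableOn_compact isCompact_Icc
  have hle : ∀ᵐ τ ∂(volume.restrict (Icc a b)), ‖k (τ - σ) • cross (φ τ) d‖ ≤ K * ‖d‖ * ‖φ τ‖ := by
    filter_upwards [ae_restrict_mem measurableSet_Icc] with τ hτ
    rw [norm_smul, Real.norm_eq_abs]
    calc |k (τ - σ)| * ‖cross (φ τ) d‖ ≤ K * (‖φ τ‖ * ‖d‖) := mul_le_mul (hK τ hτ) (norm_cross_le_norm_mul_norm _ _) (norm_nonneg _) hK0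
      _ = K * ‖d‖ * ‖φ τ‖ := by ring
  refine (norm_integral_le_of_norm_le (hint.const_mul (K * ‖d‖)) hle).trans (le_of_eq ?_)
  exact MeasureTheory.integral_const_mul _ _

/-! ## §3 Full equation ⇒ local sourced equation -/

/-- The full nonlocal equation read as the LOCAL sourced equation with source `gx + cst • I` (`I` the nonlocal term). [folklore] -/
theorem local_of_full {wv wp α cst mσ : ℝ} {x y gx I : EuclideanSpace ℝ (Fin 3)} {d e : EuclideanSpace ℝ (Fin 3)}
    (h : cst • (mσ • cross x d - I) + (1 / 2 : ℝ) • x + α • cross e x + wp • x + wv • y = gx) :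
    wv • y + (1 / 2 : ℝ) • x + wp • x + α • cross e x + (cst * mσ) • cross x d = gx + cst • I := by
  rw [← h, smul_sub, mul_smul]
  abel

/-! ## §4 The sup bound of the edge-sourced density by its atoms -/

/-- **THE EDGE-SOURCED DENSITY IS BOUNDED IN SUP NORM BY ITS ATOMS, explicitly.**  `S = [a, b] ∋ c`, slip `w ∈ C¹` with `w(c) = 0`, `w′ ≥ −1 + 2ε` on `S`
and the linear opening `κ₁(s − c) ≤ w(s)` on `[c, b]`, `κ₁(c − s) ≤ −w(s)` on `[a, c]`; even continuous kernel with `|k(τ − σ)| ≤ K` on `S × S`; continuous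
weight `m`.  Every solution `φ` of the edge-sourced model adjoint equation on `S ∖ {c}` which is continuous on `S`, differentiable on `S ∖ {c}` and bounded
satisfies, at EVERY station of `S`,
`‖φ(σ)‖ ≤ |cst| K ‖d‖ (‖e₊‖ + ‖e₋‖) · (1 + |cst| K ‖d‖ (b − a)/ε) / κ₁`. [folklore] -/
theorem edge_density_sup_le_atoms {a b c cst α ε M K κ₁ : ℝ} (hac : a < c) (hcb : c < b) (hε : 0 < ε) (hκ₁ : 0 < κ₁)
    {k m w w' : ℝ → ℝ} {φ φ' : ℝ → EuclideanSpace ℝ (Fin 3)} {d e ep em : EuclideanSpace ℝ (Fin 3)}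
    (hk : Continuous k) (hkev : ∀ s, k (-s) = k s) (hK : ∀ σ ∈ Icc a b, ∀ τ ∈ Icc a b, |k (τ - σ)| ≤ K) (hK0 : 0 ≤ K)
    (hw : ∀ σ, HasDerivAt w (w' σ) σ) (hw'c : Continuous w') (hwc0 : w c = 0)
    (hwR : ∀ s ∈ Icc c b, κ₁ * (s - c) ≤ w s) (hwL : ∀ s ∈ Icc a c, κ₁ * (c - s) ≤ -w s)
    (hgrowth : ∀ σ ∈ Icc a b, -1 + 2 * ε ≤ w' σ)
    (hφc : ContinuousOn φ (Icc a b)) (hφ : ∀ σ ∈ Icc a b, σ ≠ c → HasDerivAt φ (φ' σ) σ) (hbdd : ∀ σ ∈ Icc a b, ‖φ σ‖ ≤ M)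
    (heq : ∀ σ ∈ Icc a b, σ ≠ c →
      cst • (m σ • cross (φ σ) d - ∫ τ in Icc a b, k (τ - σ) • cross (φ τ) d)
        + (1 / 2 : ℝ) • φ σ + α • cross e (φ σ) + w' σ • φ σ + w σ • φ' σ
        = cst • (k (σ - b) • cross ep d + k (σ - a) • cross em d)) :
    ∀ σ ∈ Icc a b, ‖φ σ‖ ≤ |cst| * K * ‖d‖ * (‖ep‖ + ‖em‖) * (1 + |cst| * K * ‖d‖ * (b - a) / ε) / κ₁ := by
  have hab : a < b := hac.trans hcb
  set A : ℝ := |cst| * K * ‖d‖ * (‖ep‖ + ‖em‖) with hA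
  have hA0 : 0 ≤ A := by rw [hA]; positivity
  have hwa : w a ≤ 0 := by
    have := hwL a ⟨le_rfl, hac.le⟩; nlinarith [mul_pos hκ₁ (sub_pos.2 hac)]
  have hwb : 0 ≤ w b := (mul_nonneg hκ₁.le (sub_nonneg.2 hcb.le)).trans (hwR b ⟨hcb.le, le_rfl⟩)
  -- Step 1: the `L²` bound of the density by the atoms (p832351), as a set integral over the ball
  have hL2 := edge_density_l2_le_atoms hac hcb hε hk hkev hK hK0 hw hw'c hwc0 hwa hwb hgrowth hφ hbdd heq
  have hL2' : ∫ σ in Icc a b, ‖φ σ‖ ^ 2 ≤ (ε ^ 2)⁻¹ * ((b - a) * A ^ 2) := by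
    rw [integral_Icc_eq_integral_Ioc, ← intervalIntegral.integral_of_le hab.le]; exact hL2
  -- Step 2: the `L¹` size: `∫_S ‖φ‖ ≤ (b − a) A / ε`
  have hn1 : IntegrableOn (fun σ => ‖φ σ‖) (Icc a b) := hφc.norm.integrableOn_compact isCompact_Icc
  have hn2 : IntegrableOn (fun σ => ‖φ σ‖ ^ 2) (Icc a b) := (hφc.norm.pow 2).integrableOn_compact isCompact_Icc
  have hL1 : ∫ σ in Icc a b, ‖φ σ‖ ≤ (b - a) * A / ε := by
    have hsq := sq_setIntegral_le_mul_setIntegral_sq hab hn1 hn2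
    have h2 : (∫ σ in Icc a b, ‖φ σ‖) ^ 2 ≤ ((b - a) * A / ε) ^ 2 := by
      refine hsq.trans ?_
      have hba : 0 ≤ b - a := by linarith
      calc (b - a) * ∫ σ in Icc a b, ‖φ σ‖ ^ 2 ≤ (b - a) * ((ε ^ 2)⁻¹ * ((b - a) * A ^ 2)) :=
            mul_le_mul_of_nonneg_left hL2' hba
        _ = ((b - a) * A / ε) ^ 2 := by field_simp
    have hnn : 0 ≤ ∫ σ in Icc a b, ‖φ σ‖ := integral_nonneg fun σ => norm_nonneg _
    have hnn' : 0 ≤ (b - a) * A / ε := by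
      have hba : 0 ≤ b - a := by linarith
      positivity
    exact (pow_le_pow_iff_left₀ hnn hnn' two_ne_zero).1 h2
  -- Step 3: the local source `edge kernels + cst • nonlocal term` is bounded by `G := A (1 + |cst| K ‖d‖ (b − a)/ε)`
  set G : ℝ := A * (1 + |cst| * K * ‖d‖ * (b - a) / ε) with hG
  have hcx : ∀ x : EuclideanSpace ℝ (Fin 3), ‖cross x d‖ ≤ ‖x‖ * ‖d‖ := fun x => norm_cross_le_norm_mul_norm x d
  have hedge : ∀ σ ∈ Icc a b, ‖cst • (k (σ - b) • cross ep d + k (σ - a) • cross em d)‖ ≤ A := by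
    intro σ hσ
    have hkb : |k (σ - b)| ≤ K := hK b ⟨hab.le, le_rfl⟩ σ hσ
    have hka : |k (σ - a)| ≤ K := hK a ⟨le_rfl, hab.le⟩ σ hσ
    rw [norm_smul, Real.norm_eq_abs]
    have h2 : ‖k (σ - b) • cross ep d + k (σ - a) • cross em d‖ ≤ K * (‖ep‖ * ‖d‖) + K * (‖em‖ * ‖d‖) := by
      refine (norm_add_le _ _).trans (add_le_add ?_ ?_)
      · rw [norm_smul, Real.norm_eq_abs]; exact mul_le_mul hkb (hcx _) (norm_nonneg _) hK0
      · rw [norm_smul, Real.norm_eq_abs]; exact mul_le_mul hka (hcx _) (norm_nonneg _) hK0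
    calc |cst| * ‖k (σ - b) • cross ep d + k (σ - a) • cross em d‖
        ≤ |cst| * (K * (‖ep‖ * ‖d‖) + K * (‖em‖ * ‖d‖)) := mul_le_mul_of_nonneg_left h2 (abs_nonneg _)
      _ = A := by rw [hA]; ring
  have hsource : ∀ σ ∈ Icc a b,
      ‖cst • (k (σ - b) • cross ep d + k (σ - a) • cross em d) + cst • ∫ τ in Icc a b, k (τ - σ) • cross (φ τ) d‖ ≤ G := by
    intro σ hσ
    have hN := norm_nonlocal_le_of_sq d (fun τ hτ => hK σ hσ τ hτ) hK0 hφc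
    have h1 := hedge σ hσ
    have h2 : ‖cst • ∫ τ in Icc a b, k (τ - σ) • cross (φ τ) d‖ ≤ |cst| * (K * ‖d‖ * ((b - a) * A / ε)) := by
      rw [norm_smul, Real.norm_eq_abs]
      exact mul_le_mul_of_nonneg_left (hN.trans (mul_le_mul_of_nonneg_left hL1 (by positivity))) (abs_nonneg _)
    have hε0 : ε ≠ 0 := hε.ne'
    calc ‖cst • (k (σ - b) • cross ep d + k (σ - a) • cross em d) + cst • ∫ τ in Icc a b, k (τ - σ) • cross (φ τ) d‖
        ≤ ‖cst • (k (σ - b) • cross ep d + k (σ - a) • cross em d)‖ + ‖cst • ∫ τ in Icc a b, k (τ - σ) • cross (φ τ) d‖ :=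
          norm_add_le _ _
      _ ≤ A + |cst| * (K * ‖d‖ * ((b - a) * A / ε)) := add_le_add h1 h2
      _ = G := by rw [hG]; field_simp
  -- Step 4: the local sourced equation on `S ∖ {c}`
  have hloc : ∀ σ ∈ Icc a b, σ ≠ c →
      w σ • φ' σ + (1 / 2 : ℝ) • φ σ + w' σ • φ σ + α • cross e (φ σ) + (cst * m σ) • cross (φ σ) d
        = cst • (k (σ - b) • cross ep d + k (σ - a) • cross em d) + cst • ∫ τ in Icc a b, k (τ - σ) • cross (φ τ) d :=
    fun σ hσ hσc => local_of_full (heq σ hσ hσc)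
  have hwcont : Continuous w := continuous_iff_continuousAt.2 fun s => (hw s).continuousAt
  have hw0 : Tendsto w (𝓝 c) (𝓝 0) := by simpa [hwc0] using hwcont.continuousAt.tendsto (x := c)
  -- Step 5: right half-ball `(c, b]`
  have hright : ∀ σ ∈ Ioc c b, ‖φ σ‖ ≤ G / κ₁ := by
    intro σ hσ
    have hsub : Ioc c b ⊆ Icc a b := fun x hx => ⟨hac.le.trans hx.1.le, hx.2⟩
    have hreg : Tendsto (fun s => w s * ‖φ s‖) (𝓝[>] c) (𝓝 0) :=
      waistRegular_of_bounded_right (hw0.mono_left nhdsWithin_le_nhds)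
        (eventually_of_mem (Ioc_mem_nhdsGT hcb) fun s hs => hbdd s (hsub hs))
    exact norm_le_of_waistRegular_right (σ₁ := b) hκ₁ (fun s hs => hwR s ⟨hs.1.le, hs.2⟩) (fun s _ => hw s)
      (fun s hs => hφ s (hsub hs) (ne_of_gt hs.1)) (fun s hs => hsource s (hsub hs)) (fun s hs => hloc s (hsub hs) (ne_of_gt hs.1))
      hreg hσ
  -- Step 6: left half-ball `[a, c)`
  have hleft : ∀ σ ∈ Ico a c, ‖φ σ‖ ≤ G / κ₁ := by
    intro σ hσ
    have hsub : Ico a c ⊆ Icc a b := fun x hx => ⟨hx.1, hx.2.le.trans hcb.le⟩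
    have hwnp : ∀ s ∈ Ico a c, w s ≤ 0 := fun s hs => by
      have := hwL s ⟨hs.1, hs.2.le⟩; nlinarith [mul_nonneg hκ₁.le (sub_nonneg.2 hs.2.le)]
    have hreg : Tendsto (fun s => w s * ‖φ s‖) (𝓝[<] c) (𝓝 0) := by
      refine squeeze_zero_norm' (a := fun s => |w s| * M) ?_ ?_
      · filter_upwards [eventually_of_mem (Ico_mem_nhdsLT hac) fun s hs => hbdd s (hsub hs)] with s hs
        rw [norm_mul, Real.norm_eq_abs, Real.norm_eq_abs, abs_norm]
        exact mul_le_mul_of_nonneg_left hs (abs_nonneg _)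
      · simpa using (hw0.mono_left nhdsWithin_le_nhds).abs.mul_const M
    have hG0 : 0 ≤ G := (norm_nonneg _).trans (hsource a ⟨le_rfl, hab.le⟩)
    have h := wnorm_le_of_waistRegular_left (σ₁ := a) (G := G) (fun s _ => hw s) (fun s hs => hφ s (hsub hs) (ne_of_lt hs.2)) hwnp
      (fun s hs => hsource s (hsub hs)) (fun s hs => hloc s (hsub hs) (ne_of_lt hs.2)) hreg hσ
    -- `|w σ| ‖φ σ‖ ≤ G (c − σ)` and `|w σ| ≥ κ₁ (c − σ) > 0`
    have hcs : 0 < c - σ := sub_pos.2 hσ.2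
    have hwabs : κ₁ * (c - σ) ≤ |w σ| := by
      have h1 := hwL σ ⟨hσ.1, hσ.2.le⟩
      have : |w σ| = -w σ := abs_of_nonpos (hwnp σ hσ)
      rw [this]; exact h1
    rw [le_div_iff₀ hκ₁]
    have h3 : κ₁ * (c - σ) * ‖φ σ‖ ≤ G * (c - σ) := (mul_le_mul_of_nonneg_right hwabs (norm_nonneg _)).trans h
    nlinarith [norm_nonneg (φ σ), hG0]
  -- Step 7: the waist station itself, by continuity from the right
  have hcenter : ‖φ c‖ ≤ G / κ₁ := by
    have hcw : ContinuousWithinAt φ (Ioo c b) c := (hφc c ⟨hac.le, hcb.le⟩).mono fun x hx => ⟨hac.le.trans hx.1.le, hx.2.le⟩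
    have ht : Tendsto (fun s => ‖φ s‖) (𝓝[Ioo c b] c) (𝓝 ‖φ c‖) := hcw.tendsto.norm
    rw [nhdsWithin_Ioo_eq_nhdsGT hcb] at ht
    exact le_of_tendsto ht (eventually_of_mem (Ioo_mem_nhdsGT hcb) fun s hs => hright s ⟨hs.1, hs.2.le⟩)
  -- assemble
  intro σ hσ
  have hGκ : G / κ₁ = |cst| * K * ‖d‖ * (‖ep‖ + ‖em‖) * (1 + |cst| * K * ‖d‖ * (b - a) / ε) / κ₁ := by rw [hG, hA]
  rw [← hGκ]
  rcases lt_trichotomy σ c with hlt | heq' | hgt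
  · exact hleft σ ⟨hσ.1, hlt⟩
  · rw [heq']; exact hcenter
  · exact hright σ ⟨hgt, hσ.2⟩

end Summit.NavierStokesRegularity.NavierStokesRegularity.Theorems.Clause13REdgeDensityBounds

end
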